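import Mathlib.Combinatorics.SimpleGraph.Walk.Counting
import Mathlib.Combinatorics.SimpleGraph.Paths
import Mathlib.Combinatorics.SimpleGraph.DeleteEdges
import Mathlib.Topology.Algebra.InfiniteSum.ENNReal
import Summits.CriticalPhenomena.SAWScalingLimit.Theorems.SAWTotalPositivityBoundaryTP2Defs
import Summits.CriticalPhenomena.SAWScalingLimit.Theorems.SAWTotalPositivityBoundaryTP2Kernel
import Summits.CriticalPhenomena.SAWScalingLimit.Theorems.SAWTotalPositivityBoundaryTP2Symmetry
import Summits.CriticalPhenomena.SAWScalingLimit.Theorems.SAWTotalPositivityBoundaryTP2SectorSplit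
import HarnessLib

/-!
# Crux `BoundaryTP2` (stmt-CriticalPhenomena-7115), line `corner-deletion-induction`: Cauchy–Binet for the single-crossing sector

Let `(A, Aᶜ)` be a vertex cut of a graph `H` with `p₁, p₄ ∈ A` and `p₂, p₃ ∉ A`, let `Z_A`, `Z_B` be the
fugacity-`x` self-avoiding path kernels (`pathKernel`) of the parts
`G_A = SimpleGraph.fromRel (H.Adj a b ∧ a ∈ A ∧ b ∈ A)`, `G_B = SimpleGraph.fromRel (H.Adj a b ∧ a ∉ A ∧ b ∉ A)`
of `H`, and let `Z¹(a,b)` be the kernel of `H` restricted to the **single-crossing sector** (self-avoiding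
paths `a → b` with exactly one dart across the cut, in either direction). For cut darts `d = u → v`,
`d' = u' → v'` (`u, u' ∈ A`, `v, v' ∉ A`) put `ℓ₁ = Z_A(p₁,u) Z_A(p₄,u')`, `ℓ₂ = Z_A(p₁,u') Z_A(p₄,u)`,
`μ₁ = Z_B(v,p₂) Z_B(v',p₃)`, `μ₂ = Z_B(v,p₃) Z_B(v',p₂)`.

**Cauchy–Binet for the single-crossing sector** (`singleCrossing_cauchyBinet`, registered stub of the
crux; toolkit for the renewal / Cauchy–Binet expansion across a cut): if
`ℓ₁ μ₂ + ℓ₂ μ₁ ≤ ℓ₁ μ₁ + ℓ₂ μ₂` for every ordered pair of distinct cut darts, then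
`Z¹(p₁,p₃) Z¹(p₄,p₂) ≤ Z¹(p₁,p₂) Z¹(p₄,p₃)`. Proof: by the sector decomposition
`Z¹(a,b) = x · Σ_d Z_A(a,u) Z_B(v,b)` (`pathKernelOn_singleCrossing_eq`, file
`SAWTotalPositivityBoundaryTP2SectorSplit.lean`) both sides are `x²` times a double sum over ordered pairs
`(d, d')` of cut darts, with terms `F d d' = Z_A(p₁,u) Z_B(v,p₃) Z_A(p₄,u') Z_B(v',p₂)`, resp.
`G d d' = Z_A(p₁,u) Z_B(v,p₂) Z_A(p₄,u') Z_B(v',p₃)`; `F d d = G d d`, and for `d ≠ d'` the sign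
hypothesis is `F d d' + F d' d ≤ G d d' + G d' d`; summing over all ordered pairs, `2 Σ F ≤ 2 Σ G`.
All sums are unconditional sums in `ℝ≥0∞`; no finiteness is needed. Everything here is proved. [folklore]
-/

noncomputable section

namespace Summit.CriticalPhenomena.SAWScalingLimit.Theorems.BoundaryTP2

open scoped ENNReal

variable {V : Type*}

/-! ## Cauchy–Binet for the single-crossing sector -/

/-- The product of two sums over the cut darts is a double sum (Fubini in `ℝ≥0∞`). [folklore] -/
private theorem tsum_mul_tsum_eq {ι : Type*} (f g : ι → ℝ≥0∞) :
    (∑' d, f d) * (∑' d, g d) = ∑' d, ∑' d', f d * g d' := by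
  rw [← ENNReal.tsum_mul_right]
  exact tsum_congr fun d => ENNReal.tsum_mul_left.symm

/-- Symmetrising a double sum doubles it: `Σ_{d,d'} (F d d' + F d' d) = 2 Σ_{d,d'} F d d'`. [folklore] -/
private theorem tsum_tsum_add_swap {ι : Type*} (F : ι → ι → ℝ≥0∞) :
    ∑' d, ∑' d', (F d d' + F d' d) = 2 * ∑' d, ∑' d', F d d' := by
  rw [two_mul]
  conv_rhs => arg 2; rw [ENNReal.tsum_comm]
  rw [← ENNReal.tsum_add]
  exact tsum_congr fun d => ENNReal.tsum_add

open Classical in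
/-- **Cauchy–Binet for the single-crossing sector** (registered stub `singleCrossing_cauchyBinet` of
crux `BoundaryTP2`, toolkit of the line `corner-deletion-induction` / `renewal-cauchy-binet`). Let
`(A, Aᶜ)` be a vertex cut of `H` with `p₁, p₄ ∈ A`, `p₂, p₃ ∉ A`, let `Z_A`, `Z_{Aᶜ}` be the path
kernels of the parts `SimpleGraph.fromRel (H.Adj a b ∧ a ∈ A ∧ b ∈ A)`,
`SimpleGraph.fromRel (H.Adj a b ∧ a ∉ A ∧ b ∉ A)` of `H`, and for cut darts `u → v`, `u' → v'`
(`u, u' ∈ A`, `v, v' ∉ A`) put `ℓ₁ = Z_A(p₁,u) Z_A(p₄,u')`, `ℓ₂ = Z_A(p₁,u') Z_A(p₄,u)`,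
`μ₁ = Z_{Aᶜ}(v,p₂) Z_{Aᶜ}(v',p₃)`, `μ₂ = Z_{Aᶜ}(v,p₃) Z_{Aᶜ}(v',p₂)`. If
`ℓ₁ μ₂ + ℓ₂ μ₁ ≤ ℓ₁ μ₁ + ℓ₂ μ₂` for every ordered pair of distinct cut darts (`hsign`), then the
single-crossing kernels `Z¹(a,b) = pathKernelOn H x a b {γ | γ has exactly one dart across the cut}`
satisfy `Z¹(p₁,p₃) Z¹(p₄,p₂) ≤ Z¹(p₁,p₂) Z¹(p₄,p₃)`. Proof: by the sector decomposition
(`pathKernelOn_singleCrossing_eq`) both sides are `x²` times a double sum over ordered pairs `(d, d')`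
of cut darts, of `F d d' = ℓ₁ μ₂`-type, resp. `G d d' = ℓ₁ μ₁`-type, terms; `F d d = G d d`, and for
`d ≠ d'` the sign hypothesis reads `F d d' + F d' d ≤ G d d' + G d' d`; summing over all ordered
pairs gives `2 Σ F ≤ 2 Σ G`. The hypotheses `hfin`, `p₂ ∉ A`, `p₃ ∉ A` of the registered signature
are not used (all sums are unconditional sums in `ℝ≥0∞`, and the sector decomposition holds for any
endpoint). [folklore] -/
theorem singleCrossing_cauchyBinet (H : SimpleGraph V) (x : ℝ) (hx : 0 ≤ x)
    (_hfin : H.support.Finite) (A : Set V) (p₁ p₂ p₃ p₄ : V)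
    (h₁ : p₁ ∈ A) (h₄ : p₄ ∈ A) (_h₂ : p₂ ∉ A) (_h₃ : p₃ ∉ A)
    (hsign : ∀ u v u' v' : V, H.Adj u v → u ∈ A → v ∉ A → H.Adj u' v' → u' ∈ A → v' ∉ A →
      (u ≠ u' ∨ v ≠ v') →
      pathKernel (SimpleGraph.fromRel fun a b => H.Adj a b ∧ a ∈ A ∧ b ∈ A) x p₁ u *
            pathKernel (SimpleGraph.fromRel fun a b => H.Adj a b ∧ a ∈ A ∧ b ∈ A) x p₄ u' *
          (pathKernel (SimpleGraph.fromRel fun a b => H.Adj a b ∧ a ∉ A ∧ b ∉ A) x v p₃ *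
            pathKernel (SimpleGraph.fromRel fun a b => H.Adj a b ∧ a ∉ A ∧ b ∉ A) x v' p₂) +
        pathKernel (SimpleGraph.fromRel fun a b => H.Adj a b ∧ a ∈ A ∧ b ∈ A) x p₁ u' *
            pathKernel (SimpleGraph.fromRel fun a b => H.Adj a b ∧ a ∈ A ∧ b ∈ A) x p₄ u *
          (pathKernel (SimpleGraph.fromRel fun a b => H.Adj a b ∧ a ∉ A ∧ b ∉ A) x v p₂ *
            pathKernel (SimpleGraph.fromRel fun a b => H.Adj a b ∧ a ∉ A ∧ b ∉ A) x v' p₃) ≤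
      pathKernel (SimpleGraph.fromRel fun a b => H.Adj a b ∧ a ∈ A ∧ b ∈ A) x p₁ u *
            pathKernel (SimpleGraph.fromRel fun a b => H.Adj a b ∧ a ∈ A ∧ b ∈ A) x p₄ u' *
          (pathKernel (SimpleGraph.fromRel fun a b => H.Adj a b ∧ a ∉ A ∧ b ∉ A) x v p₂ *
            pathKernel (SimpleGraph.fromRel fun a b => H.Adj a b ∧ a ∉ A ∧ b ∉ A) x v' p₃) +
        pathKernel (SimpleGraph.fromRel fun a b => H.Adj a b ∧ a ∈ A ∧ b ∈ A) x p₁ u' *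
            pathKernel (SimpleGraph.fromRel fun a b => H.Adj a b ∧ a ∈ A ∧ b ∈ A) x p₄ u *
          (pathKernel (SimpleGraph.fromRel fun a b => H.Adj a b ∧ a ∉ A ∧ b ∉ A) x v p₃ *
            pathKernel (SimpleGraph.fromRel fun a b => H.Adj a b ∧ a ∉ A ∧ b ∉ A) x v' p₂)) :
    pathKernelOn H x p₁ p₃ {γ | (γ.1.darts.countP fun d => decide (d.fst ∈ A ↔ d.snd ∉ A)) = 1} *
        pathKernelOn H x p₄ p₂ {γ | (γ.1.darts.countP fun d => decide (d.fst ∈ A ↔ d.snd ∉ A)) = 1} ≤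
      pathKernelOn H x p₁ p₂ {γ | (γ.1.darts.countP fun d => decide (d.fst ∈ A ↔ d.snd ∉ A)) = 1} *
        pathKernelOn H x p₄ p₃ {γ | (γ.1.darts.countP fun d => decide (d.fst ∈ A ↔ d.snd ∉ A)) = 1} := by
  set GA := SimpleGraph.fromRel fun a b => H.Adj a b ∧ a ∈ A ∧ b ∈ A with hGA
  set GB := SimpleGraph.fromRel fun a b => H.Adj a b ∧ a ∉ A ∧ b ∉ A with hGB
  rw [pathKernelOn_singleCrossing_eq H x hx A p₁ p₃ h₁, pathKernelOn_singleCrossing_eq H x hx A p₄ p₂ h₄,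
    pathKernelOn_singleCrossing_eq H x hx A p₁ p₂ h₁, pathKernelOn_singleCrossing_eq H x hx A p₄ p₃ h₄]
  -- the side kernels attached to a cut dart `d = (u, v)`
  set α : {d : V × V // H.Adj d.1 d.2 ∧ d.1 ∈ A ∧ d.2 ∉ A} → ℝ≥0∞ :=
    fun d => pathKernel GA x p₁ d.1.1 with hα
  set β : {d : V × V // H.Adj d.1 d.2 ∧ d.1 ∈ A ∧ d.2 ∉ A} → ℝ≥0∞ :=
    fun d => pathKernel GA x p₄ d.1.1 with hβ
  set γ : {d : V × V // H.Adj d.1 d.2 ∧ d.1 ∈ A ∧ d.2 ∉ A} → ℝ≥0∞ :=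
    fun d => pathKernel GB x d.1.2 p₂ with hγ
  set δ : {d : V × V // H.Adj d.1 d.2 ∧ d.1 ∈ A ∧ d.2 ∉ A} → ℝ≥0∞ :=
    fun d => pathKernel GB x d.1.2 p₃ with hδ
  -- termwise comparison of the symmetrised double sums
  have hterm : ∀ d d' : {d : V × V // H.Adj d.1 d.2 ∧ d.1 ∈ A ∧ d.2 ∉ A},
      α d * δ d * (β d' * γ d') + α d' * δ d' * (β d * γ d) ≤
        α d * γ d * (β d' * δ d') + α d' * γ d' * (β d * δ d) := by
    intro d d'
    by_cases hdd : d = d'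
    · subst hdd
      exact le_of_eq (by ring)
    · have hne : d.1.1 ≠ d'.1.1 ∨ d.1.2 ≠ d'.1.2 :=
        not_and_or.1 fun hcon => hdd (Subtype.ext (Prod.ext hcon.1 hcon.2))
      have key := hsign d.1.1 d.1.2 d'.1.1 d'.1.2 d.2.1 d.2.2.1 d.2.2.2 d'.2.1 d'.2.2.1 d'.2.2.2 hne
      simp only [hα, hβ, hγ, hδ]
      convert key using 1 <;> ring
  have hsum : ∑' d, ∑' d', α d * δ d * (β d' * γ d') ≤ ∑' d, ∑' d', α d * γ d * (β d' * δ d') := by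
    have hle : ∑' d, ∑' d', (α d * δ d * (β d' * γ d') + α d' * δ d' * (β d * γ d)) ≤
        ∑' d, ∑' d', (α d * γ d * (β d' * δ d') + α d' * γ d' * (β d * δ d)) :=
      ENNReal.tsum_le_tsum fun d => ENNReal.tsum_le_tsum fun d' => hterm d d'
    rw [tsum_tsum_add_swap (fun d d' => α d * δ d * (β d' * γ d')),
      tsum_tsum_add_swap (fun d d' => α d * γ d * (β d' * δ d'))] at hle
    exact (ENNReal.mul_le_mul_iff_right two_ne_zero ENNReal.ofNat_ne_top).1 hle
  have hprod : (∑' d, α d * δ d) * (∑' d, β d * γ d) ≤ (∑' d, α d * γ d) * (∑' d, β d * δ d) := by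
    rw [tsum_mul_tsum_eq, tsum_mul_tsum_eq]
    exact hsum
  calc ENNReal.ofReal x * (∑' d, α d * δ d) * (ENNReal.ofReal x * (∑' d, β d * γ d))
      = ENNReal.ofReal x * ENNReal.ofReal x * ((∑' d, α d * δ d) * (∑' d, β d * γ d)) := by ring
    _ ≤ ENNReal.ofReal x * ENNReal.ofReal x * ((∑' d, α d * γ d) * (∑' d, β d * δ d)) :=
        mul_le_mul_right hprod _
    _ = ENNReal.ofReal x * (∑' d, α d * γ d) * (ENNReal.ofReal x * (∑' d, β d * δ d)) := by ring

end Summit.CriticalPhenomena.SAWScalingLimit.Theorems.BoundaryTP2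

end
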